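import Mathlib.Analysis.Distribution.SchwartzSpace.Basic
import Mathlib.Analysis.LocallyConvex.HahnBanach
import Mathlib.Topology.UniformSpace.Cauchy
import Mathlib.Topology.Metrizable.Basic
import Mathlib.Order.Filter.IsBounded
import Literature.Analysis.FunctionSpaces.NuclearSpaceSchwartzSeparableProofs
import Literature.Analysis.FunctionSpaces.DiagonalWeakLimits
import HarnessLib

/-!
# Subsequential limits of equicontinuous families of functionals on Schwartz spaces

Analysis/FunctionSpaces support file (theorems only, fully proved): the compactness step
"pass to a subsequence along which all the (lattice / regularised / approximate) `n`-point
functions converge, and call the limits `S_n`" of constructive field theory and of every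
"bounded sequence of distributions" argument, in the generality those arguments actually use:

* a **countable family** of Schwartz spaces `𝓢(E i, ℂ)`, `i : ι` (e.g. `E n = (Fin n → ℝ^d)`,
  all `n` at once), and for each `i` a sequence `u k i : 𝓢(E i, ℂ) →L[ℂ] F`, `k : ℕ`;
* the uniform bound `‖u k i θ‖ ≤ C i · (s i).sup p (θ)` by finitely many Schwartz seminorms is
  only asked **eventually in `k`** (for `k ≥ k₀(i)`) and only for `θ` in a **linear subspace**
  `M i ⊆ 𝓢(E i, ℂ)` (e.g. Osterwalder–Schrader's `⁰𝒮`, the test functions vanishing with all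
  derivatives on the diagonals, where alone lattice `n`-point functions are bounded uniformly in
  the spacing);
* conclusion: ONE strictly increasing `φ : ℕ → ℕ` and continuous linear functionals `v i` on the
  WHOLE space with `u (φ j) i θ → v i θ` for every `i` and every `θ ∈ M i`, and
  `‖v i θ‖ ≤ C i · (s i).sup p (θ)` for ALL `θ` (Hahn–Banach).

Contents:

* `secondCountableTopology_schwartzMap`, `exists_countable_dense_subset_schwartzMap` — `𝓢(E, V)`
  (`E`, `V` finite-dimensional) is second countable, so every subset, in particular every linear
  subspace, contains a countable subset dense in it (separability of `𝓢`, the tree's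
  `separableSpace_schwartzMap_holds`, plus metrisability of the Fréchet space `𝓢`);
* `exists_strictMono_forall_submodule_tendsto` — the diagonal extraction: along one subsequence
  all `u (φ j) i θ`, `θ ∈ M i`, converge (Cantor diagonal on `Σ i, D i` with `D i ⊆ M i` countable
  dense, the tree's `exists_strictMono_forall_tendsto`, then `ε/3`);
* `exists_linearMap_of_tendsto_on_submodule` — pointwise limits of linear maps on a subspace form a
  linear map; `exists_clm_extension_of_le_seminorm` — a linear functional on a subspace of
  `𝓢(E, ℂ)` dominated by `C · (s.sup p)` extends to a continuous linear functional on `𝓢(E, ℂ)`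
  with the same domination (Mathlib's Hahn–Banach `Module.Dual.exists_extension_of_le_seminorm`
  and `SchwartzMap.mkCLMtoNormedSpace`);
* `exists_strictMono_forall_clm_tendsto_on_submodule` (**main theorem**, scalar values) and
  `exists_strictMono_forall_clm_tendsto` (bounds on all of `𝓢`, values in a proper space `F`,
  no Hahn–Banach needed); single-space forms `exists_strictMono_clm_tendsto_on_submodule`,
  `exists_strictMono_clm_tendsto`.

The single-space, everywhere-bounded, not-eventual case with values in `𝓢'` is the tree's
`TemperedDistribution.exists_strictMono_tendsto_of_seminorm_bound`
(`TemperedWeakStarCompactness.lean`); this file is its refinement for families, subspaces and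
eventual bounds, phrased with `→L[ℂ]` (the shape of the tree's `SchwingerFamily`). Deliberately
NOT here: anything about `⁰𝒮` itself or Schwinger functions (that specialisation is one
application with `ι = ℕ`, `E n = (Fin n → ℝ^d)`, `M n = ⁰𝒮ₙ`, `(s n).sup p ≤ |·|_{m n}`).

## References

* W. Rudin, *Functional Analysis*, 2nd ed. (1991): Thm. 3.3 (Hahn–Banach, complex scalars,
  domination by a seminorm), Thm. 2.6/2.8 (Banach–Steinhaus and pointwise limits), Thm. 1.24 and
  7.4 (a) (`𝒮` is a Fréchet space, metrisable). [cite: Rudin1991, Thm 3.3]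
* K. Osterwalder, R. Schrader, *Axioms for Euclidean Green's functions II*, CMP 42 (1975), §2
  (the spaces `⁰𝒮`, the norms `|f|_m`, condition E0′). [cite: OsterwalderSchraderCMP1975, §2]
* J. Glimm, A. Jaffe, *Quantum Physics*, 2nd ed. (1987), §6.1 (OS axioms) and the compactness
  arguments of Part II (limits of lattice / cutoff Schwinger functions along subsequences).
-/

noncomputable section

open Filter Set Function TopologicalSpace
open _root_.Topology
open scoped SchwartzMap

namespace Literature.Analysis.FunctionSpaces

namespace SchwartzMap

/-! ### Second countability; countable dense subsets of subspaces -/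

section SecondCountable

variable (E V : Type*) [NormedAddCommGroup E] [NormedSpace ℝ E] [FiniteDimensional ℝ E]
  [NormedAddCommGroup V] [NormedSpace ℝ V] [FiniteDimensional ℝ V]

/-- **The Schwartz space is second countable** (`E`, `V` finite-dimensional): it is separable
(`separableSpace_schwartzMap_holds`, Trèves 1967, p. 556) and its uniformity is countably
generated (a Fréchet space: Rudin, *Functional Analysis*, Thm. 1.24 with 7.4 (a)), and a separable
uniform space with countably generated uniformity is second countable. Stated as a theorem; use
`haveI`. [cite: Rudin1991, Thm 1.24] -/
theorem secondCountableTopology_schwartzMap : SecondCountableTopology 𝓢(E, V) := by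
  haveI : SeparableSpace 𝓢(E, V) := separableSpace_schwartzMap_holds E V
  haveI : (uniformity 𝓢(E, V)).IsCountablyGenerated :=
    IsUniformAddGroup.uniformity_countably_generated
  exact UniformSpace.secondCountable_of_separable _

/-- Every subset `S` of the Schwartz space `𝓢(E, V)` (`E`, `V` finite-dimensional) contains a
countable subset `D ⊆ S` with `S ⊆ closure D` — in particular every linear subspace of `𝓢` is
separable in its own right (subspaces of separable metrisable spaces are separable; Rudin,
*Functional Analysis*, Thm. 1.24: `𝒮` is metrisable). [cite: Rudin1991, Thm 1.24] -/
theorem exists_countable_dense_subset_schwartzMap (S : Set 𝓢(E, V)) :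
    ∃ D : Set 𝓢(E, V), D ⊆ S ∧ D.Countable ∧ S ⊆ closure D := by
  haveI : SeparableSpace 𝓢(E, V) := separableSpace_schwartzMap_holds E V
  haveI : (uniformity 𝓢(E, V)).IsCountablyGenerated :=
    IsUniformAddGroup.uniformity_countably_generated
  exact (IsSeparable.of_separableSpace S).exists_countable_dense_subset

end SecondCountable

/-! ### Limits of linear maps on a subspace; Hahn–Banach extension with a seminorm bound -/

section Single

variable {E : Type*} [NormedAddCommGroup E] [NormedSpace ℝ E]
  {F : Type*} [NormedAddCommGroup F] [NormedSpace ℂ F]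

/-- **Pointwise limits of linear maps on a subspace are linear.** If `w j : 𝓢(E, ℂ) →L[ℂ] F`
converge at every point of a linear subspace `M`, the limit is a linear map `M →ₗ[ℂ] F`
(uniqueness of limits; Rudin, *Functional Analysis*, Thm. 2.8, algebraic half). [folklore] -/
theorem exists_linearMap_of_tendsto_on_submodule (M : Submodule ℂ 𝓢(E, ℂ))
    (w : ℕ → 𝓢(E, ℂ) →L[ℂ] F)
    (hconv : ∀ θ ∈ M, ∃ l : F, Tendsto (fun j => w j θ) atTop (𝓝 l)) :
    ∃ f : M →ₗ[ℂ] F, ∀ θ : M, Tendsto (fun j => w j θ) atTop (𝓝 (f θ)) := by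
  choose l hl using fun θ : M => hconv θ θ.2
  refine ⟨{ toFun := l, map_add' := fun θ η => ?_, map_smul' := fun c θ => ?_ }, hl⟩
  · refine tendsto_nhds_unique (hl (θ + η)) ?_
    have : (fun j => w j ((θ + η : M) : 𝓢(E, ℂ))) = fun j => w j θ + w j η := by
      funext j
      rw [Submodule.coe_add, map_add]
    rw [this]
    exact (hl θ).add (hl η)
  · refine tendsto_nhds_unique (hl (c • θ)) ?_
    have : (fun j => w j ((c • θ : M) : 𝓢(E, ℂ))) = fun j => c • w j θ := by
      funext j
      rw [Submodule.coe_smul, map_smul]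
    rw [this, RingHom.id_apply]
    exact (hl θ).const_smul c

/-- **Hahn–Banach on the Schwartz space with a seminorm bound.** A linear functional `f` on a
subspace `M ⊆ 𝓢(E, ℂ)` with `‖f θ‖ ≤ C · (s.sup p)(θ)` for finitely many Schwartz seminorms
extends to a continuous linear functional `v` on `𝓢(E, ℂ)` obeying the same bound everywhere
(Rudin, *Functional Analysis*, Thm. 3.3, through Mathlib's
`Module.Dual.exists_extension_of_le_seminorm`; continuity from the bound,
`SchwartzMap.mkCLMtoNormedSpace`). [cite: Rudin1991, Thm 3.3] -/
theorem exists_clm_extension_of_le_seminorm (M : Submodule ℂ 𝓢(E, ℂ)) (f : M →ₗ[ℂ] ℂ)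
    (s : Finset (ℕ × ℕ)) {C : ℝ} (hC : 0 ≤ C)
    (hf : ∀ θ : M, ‖f θ‖ ≤ C * (s.sup (schwartzSeminormFamily ℂ E ℂ)) θ) :
    ∃ v : 𝓢(E, ℂ) →L[ℂ] ℂ, (∀ θ : M, v θ = f θ) ∧
      ∀ θ, ‖v θ‖ ≤ C * (s.sup (schwartzSeminormFamily ℂ E ℂ)) θ := by
  set q : Seminorm ℂ 𝓢(E, ℂ) := s.sup (schwartzSeminormFamily ℂ E ℂ) with hq_def
  have hsmul : ∀ θ, (C.toNNReal • q) θ = C * q θ := fun θ => by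
    change C.toNNReal • q θ = C * q θ
    rw [NNReal.smul_def, smul_eq_mul, Real.coe_toNNReal C hC]
  obtain ⟨g, hg, hgle⟩ := Module.Dual.exists_extension_of_le_seminorm M f (p := C.toNNReal • q)
    fun θ => by rw [hsmul]; exact hf θ
  have hgb : ∀ θ, ‖g θ‖ ≤ C * q θ := fun θ => by rw [← hsmul]; exact hgle θ
  refine ⟨SchwartzMap.mkCLMtoNormedSpace g (map_add g) (fun a θ => map_smul g a θ)
      ⟨s, C, hC, hgb⟩, fun θ => hg θ, hgb⟩

end Single

/-! ### Diagonal extraction for countable families, on subspaces, with eventual bounds -/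

section Family

variable {ι : Type*} [Countable ι] {E : ι → Type*} [∀ i, NormedAddCommGroup (E i)]
  [∀ i, NormedSpace ℝ (E i)] [∀ i, FiniteDimensional ℝ (E i)]
  {F : Type*} [NormedAddCommGroup F] [NormedSpace ℂ F]

/-- **Diagonal extraction on subspaces of Schwartz spaces.** Let `ι` be countable, `E i`
finite-dimensional, `F` a proper normed space, `M i ⊆ 𝓢(E i, ℂ)` linear subspaces and
`u k i : 𝓢(E i, ℂ) →L[ℂ] F` with, for each `i`, the bound
`‖u k i θ‖ ≤ C i · ((s i).sup p)(θ)` for all `θ ∈ M i` and all sufficiently large `k`. Then along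
ONE strictly increasing `φ` every sequence `j ↦ u (φ j) i θ`, `θ ∈ M i`, converges. Proof: each
`M i` contains a countable dense `D i` (`exists_countable_dense_subset_schwartzMap`); the values
`u k i d`, `d ∈ D i`, stay in fixed compact balls (eventual bound plus finitely many initial
terms), so Cantor's diagonal procedure on the countable index set `Σ i, D i`
(`exists_strictMono_forall_tendsto`) gives convergence on every `D i`; at `θ ∈ M i` the
subsequence is Cauchy by `ε/3` through some `d ∈ D i` with `(s i).sup p (θ - d)` small, using
`θ - d ∈ M i` (Rudin, *Functional Analysis*, proof of Thm. 2.8 / the Arzelà–Ascoli pattern).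
[folklore] -/
theorem exists_strictMono_forall_submodule_tendsto [ProperSpace F]
    (M : ∀ i, Submodule ℂ 𝓢(E i, ℂ)) (u : ℕ → ∀ i, 𝓢(E i, ℂ) →L[ℂ] F)
    (s : ι → Finset (ℕ × ℕ)) (C : ι → ℝ)
    (hb : ∀ i, ∀ᶠ k in atTop, ∀ θ ∈ M i,
      ‖u k i θ‖ ≤ C i * ((s i).sup (schwartzSeminormFamily ℂ (E i) ℂ)) θ) :
    ∃ φ : ℕ → ℕ, StrictMono φ ∧
      ∀ i, ∀ θ ∈ M i, ∃ l : F, Tendsto (fun j => u (φ j) i θ) atTop (𝓝 l) := by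
  -- countable dense subsets `D i ⊆ M i`
  have hD : ∀ i, ∃ D : Set 𝓢(E i, ℂ), D ⊆ M i ∧ D.Countable ∧
      (M i : Set 𝓢(E i, ℂ)) ⊆ closure D :=
    fun i => exists_countable_dense_subset_schwartzMap (E i) ℂ (M i)
  choose D hDM hDc hMD using hD
  haveI : ∀ i, Countable (D i) := fun i => (hDc i).to_subtype
  -- Step 1: diagonal extraction on the countable index set `Σ i, D i`
  have hbdd : ∀ p : Σ i, D i, ∃ (c : F) (R : ℝ),
      ∀ k, u k p.1 (p.2 : 𝓢(E p.1, ℂ)) ∈ Metric.closedBall c R := by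
    rintro ⟨i, d, hd⟩
    have hev : ∀ᶠ k in atTop,
        ‖u k i d‖ ≤ C i * ((s i).sup (schwartzSeminormFamily ℂ (E i) ℂ)) d :=
      (hb i).mono fun k hk => hk d (hDM i hd)
    obtain ⟨R, hR⟩ := (isBoundedUnder_of_eventually_le hev).bddAbove_range
    refine ⟨0, R, fun k => ?_⟩
    rw [Metric.mem_closedBall, dist_zero_right]
    exact hR (Set.mem_range_self k)
  obtain ⟨φ, hφ, hconvD⟩ := exists_strictMono_forall_tendsto
    (fun k (p : Σ i, D i) => u k p.1 (p.2 : 𝓢(E p.1, ℂ))) hbdd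
  refine ⟨φ, hφ, fun i θ hθ => ?_⟩
  -- Step 2: Cauchy at every `θ ∈ M i` by `ε / 3`
  set q : Seminorm ℂ 𝓢(E i, ℂ) := (s i).sup (schwartzSeminormFamily ℂ (E i) ℂ) with hq_def
  have hbφ : ∀ᶠ j in atTop, ∀ η ∈ M i, ‖u (φ j) i η‖ ≤ C i * q η :=
    hφ.tendsto_atTop.eventually (hb i)
  obtain ⟨N₁, hN₁⟩ := eventually_atTop.1 hbφ
  refine cauchySeq_tendsto_of_complete (Metric.cauchySeq_iff.2 fun ε hε => ?_)
  have hδ : 0 < ε / (3 * (|C i| + 1)) := by positivity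
  have hball : q.ball θ (ε / (3 * (|C i| + 1))) ∈ 𝓝 θ :=
    ((schwartz_withSeminorms ℂ (E i) ℂ).mem_nhds_iff θ _).2 ⟨s i, _, hδ, subset_rfl⟩
  obtain ⟨d, hdB, hdD⟩ := mem_closure_iff_nhds.1 (hMD i hθ) _ hball
  rw [Seminorm.mem_ball] at hdB
  have hnear : ∀ j, N₁ ≤ j → dist (u (φ j) i θ) (u (φ j) i d) < ε / 3 := fun j hj => by
    rw [dist_eq_norm, ← map_sub]
    calc ‖u (φ j) i (θ - d)‖ ≤ C i * q (θ - d) := hN₁ j hj _ ((M i).sub_mem hθ (hDM i hdD))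
      _ = C i * q (d - θ) := by rw [map_sub_rev]
      _ ≤ (|C i| + 1) * q (d - θ) :=
          mul_le_mul_of_nonneg_right ((le_abs_self _).trans (le_add_of_nonneg_right zero_le_one))
            (apply_nonneg _ _)
      _ < (|C i| + 1) * (ε / (3 * (|C i| + 1))) := by gcongr
      _ = ε / 3 := by field_simp
  obtain ⟨l, hl⟩ := hconvD ⟨i, d, hdD⟩
  obtain ⟨N₂, hN₂⟩ := Metric.cauchySeq_iff.1 hl.cauchySeq (ε / 3) (by positivity)
  refine ⟨max N₁ N₂, fun m hm n hn => ?_⟩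
  have h₂ : dist (u (φ m) i d) (u (φ n) i d) < ε / 3 :=
    hN₂ m (le_of_max_le_right hm) n (le_of_max_le_right hn)
  calc dist (u (φ m) i θ) (u (φ n) i θ)
      ≤ dist (u (φ m) i θ) (u (φ m) i d) + dist (u (φ m) i d) (u (φ n) i d) +
          dist (u (φ n) i d) (u (φ n) i θ) := dist_triangle4 _ _ _ _
    _ < ε / 3 + ε / 3 + ε / 3 := by
        refine add_lt_add (add_lt_add (hnear m (le_of_max_le_left hm)) h₂) ?_
        rw [dist_comm]
        exact hnear n (le_of_max_le_left hn)
    _ = ε := by ring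

/-- **Subsequential limits of eventually equicontinuous families of functionals on subspaces of
Schwartz spaces** (the extraction step of every "compactness + inheritance" construction of
Schwinger functions: Osterwalder–Schrader II §2 works on `⁰𝒮`; Glimm–Jaffe, *Quantum Physics*,
Part II). Let `ι` be countable, `E i` finite-dimensional, `M i ⊆ 𝓢(E i, ℂ)` linear subspaces,
`u k i : 𝓢(E i, ℂ) →L[ℂ] ℂ`, and suppose that for each `i`, for all sufficiently large `k` and all
`θ ∈ M i`, `‖u k i θ‖ ≤ C i · ((s i).sup p)(θ)` with a finite set `s i` of Schwartz seminorms.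
Then there are ONE strictly increasing `φ : ℕ → ℕ` and continuous linear functionals
`v i : 𝓢(E i, ℂ) →L[ℂ] ℂ` with `u (φ j) i θ → v i θ` for every `i` and every `θ ∈ M i`, and
`‖v i θ‖ ≤ C i · ((s i).sup p)(θ)` for EVERY `θ` (diagonal extraction
`exists_strictMono_forall_submodule_tendsto`, linearity of the limit, the bound in the limit, and
Hahn–Banach `exists_clm_extension_of_le_seminorm`; Rudin, *Functional Analysis*, Thms. 2.8, 3.3).
[cite: Rudin1991, Thm 3.3] -/
theorem exists_strictMono_forall_clm_tendsto_on_submodule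
    (M : ∀ i, Submodule ℂ 𝓢(E i, ℂ)) (u : ℕ → ∀ i, 𝓢(E i, ℂ) →L[ℂ] ℂ)
    (s : ι → Finset (ℕ × ℕ)) (C : ι → ℝ) (hC : ∀ i, 0 ≤ C i)
    (hb : ∀ i, ∀ᶠ k in atTop, ∀ θ ∈ M i,
      ‖u k i θ‖ ≤ C i * ((s i).sup (schwartzSeminormFamily ℂ (E i) ℂ)) θ) :
    ∃ (φ : ℕ → ℕ) (v : ∀ i, 𝓢(E i, ℂ) →L[ℂ] ℂ), StrictMono φ ∧
      (∀ i, ∀ θ ∈ M i, Tendsto (fun j => u (φ j) i θ) atTop (𝓝 (v i θ))) ∧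
      ∀ i θ, ‖v i θ‖ ≤ C i * ((s i).sup (schwartzSeminormFamily ℂ (E i) ℂ)) θ := by
  obtain ⟨φ, hφ, hconv⟩ := exists_strictMono_forall_submodule_tendsto M u s C hb
  have hv : ∀ i, ∃ v : 𝓢(E i, ℂ) →L[ℂ] ℂ,
      (∀ θ ∈ M i, Tendsto (fun j => u (φ j) i θ) atTop (𝓝 (v θ))) ∧
      ∀ θ, ‖v θ‖ ≤ C i * ((s i).sup (schwartzSeminormFamily ℂ (E i) ℂ)) θ := by
    intro i
    obtain ⟨f, hf⟩ := exists_linearMap_of_tendsto_on_submodule (M i) (fun j => u (φ j) i) (hconv i)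
    have hfb : ∀ θ : M i, ‖f θ‖ ≤ C i * ((s i).sup (schwartzSeminormFamily ℂ (E i) ℂ)) θ :=
      fun θ => le_of_tendsto (hf θ).norm
        ((hφ.tendsto_atTop.eventually (hb i)).mono fun j hj => hj θ θ.2)
    obtain ⟨v, hvf, hvb⟩ := exists_clm_extension_of_le_seminorm (M i) f (s i) (hC i) hfb
    refine ⟨v, fun θ hθ => ?_, hvb⟩
    have h := hf ⟨θ, hθ⟩
    rw [← hvf ⟨θ, hθ⟩] at h
    exact h
  choose v hv hvb using hv
  exact ⟨φ, v, hφ, hv, hvb⟩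

/-- **Subsequential limits of eventually equicontinuous families, bounds on all of `𝓢`**
(values in a proper normed space `F`; no Hahn–Banach needed): for countable `ι`, `E i`
finite-dimensional and `u k i : 𝓢(E i, ℂ) →L[ℂ] F` with `‖u k i θ‖ ≤ C i · ((s i).sup p)(θ)` for
all `θ` and all sufficiently large `k`, there are one strictly increasing `φ` and
`v i : 𝓢(E i, ℂ) →L[ℂ] F` with `u (φ j) i θ → v i θ` for all `i`, `θ`, and
`‖v i θ‖ ≤ C i · ((s i).sup p)(θ)`. This is the sequential weak-* compactness of bounded sets of
tempered distributions (`𝒮` is a separable Fréchet–Montel space; Rudin, *Functional Analysis*,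
Thms. 2.6, 2.8), for countably many Schwartz spaces at once. [cite: Rudin1991, Thm 2.8] -/
theorem exists_strictMono_forall_clm_tendsto [ProperSpace F]
    (u : ℕ → ∀ i, 𝓢(E i, ℂ) →L[ℂ] F) (s : ι → Finset (ℕ × ℕ)) (C : ι → ℝ)
    (hb : ∀ i, ∀ᶠ k in atTop, ∀ θ,
      ‖u k i θ‖ ≤ C i * ((s i).sup (schwartzSeminormFamily ℂ (E i) ℂ)) θ) :
    ∃ (φ : ℕ → ℕ) (v : ∀ i, 𝓢(E i, ℂ) →L[ℂ] F), StrictMono φ ∧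
      (∀ i θ, Tendsto (fun j => u (φ j) i θ) atTop (𝓝 (v i θ))) ∧
      ∀ i θ, ‖v i θ‖ ≤ C i * ((s i).sup (schwartzSeminormFamily ℂ (E i) ℂ)) θ := by
  obtain ⟨φ, hφ, hconv⟩ := exists_strictMono_forall_submodule_tendsto (fun _ => ⊤) u s C
    fun i => (hb i).mono fun k hk θ _ => hk θ
  have hv : ∀ i, ∃ v : 𝓢(E i, ℂ) →L[ℂ] F,
      (∀ θ, Tendsto (fun j => u (φ j) i θ) atTop (𝓝 (v θ))) ∧
      ∀ θ, ‖v θ‖ ≤ C i * ((s i).sup (schwartzSeminormFamily ℂ (E i) ℂ)) θ := by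
    intro i
    choose l hl using fun θ => hconv i θ Submodule.mem_top
    have hlim : Tendsto (fun j θ => u (φ j) i θ) atTop (𝓝 l) := tendsto_pi_nhds.2 hl
    let f : 𝓢(E i, ℂ) →ₗ[ℂ] F :=
      linearMapOfTendsto l (fun j => (u (φ j) i : 𝓢(E i, ℂ) →ₗ[ℂ] F)) hlim
    have hfl : ∀ θ, f θ = l θ := fun _ => rfl
    have hfb : ∀ θ, ‖f θ‖ ≤ C i * ((s i).sup (schwartzSeminormFamily ℂ (E i) ℂ)) θ :=
      fun θ => le_of_tendsto (hl θ).norm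
        ((hφ.tendsto_atTop.eventually (hb i)).mono fun j hj => hj θ)
    have hfb' : ∀ θ, ‖f θ‖ ≤ |C i| * ((s i).sup (schwartzSeminormFamily ℂ (E i) ℂ)) θ :=
      fun θ => (hfb θ).trans (mul_le_mul_of_nonneg_right (le_abs_self _) (apply_nonneg _ _))
    refine ⟨SchwartzMap.mkCLMtoNormedSpace f (map_add f) (fun a θ => map_smul f a θ)
      ⟨s i, |C i|, abs_nonneg _, hfb'⟩, fun θ => hl θ, hfb⟩
  choose v hv hvb using hv
  exact ⟨φ, v, hφ, hv, hvb⟩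

end Family

/-! ### One Schwartz space -/

section One

variable {E : Type*} [NormedAddCommGroup E] [NormedSpace ℝ E] [FiniteDimensional ℝ E]
  {F : Type*} [NormedAddCommGroup F] [NormedSpace ℂ F]

/-- **One space, one subspace**: if `u k : 𝓢(E, ℂ) →L[ℂ] ℂ` satisfy
`‖u k θ‖ ≤ C · (s.sup p)(θ)` for `θ` in a subspace `M` and all large `k`, then along a subsequence
`u (φ j) θ → v θ` for every `θ ∈ M`, with `v : 𝓢(E, ℂ) →L[ℂ] ℂ` obeying the bound everywhere
(`exists_strictMono_forall_clm_tendsto_on_submodule` with `ι = Unit`). [cite: Rudin1991, Thm 3.3] -/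
theorem exists_strictMono_clm_tendsto_on_submodule (M : Submodule ℂ 𝓢(E, ℂ))
    (u : ℕ → 𝓢(E, ℂ) →L[ℂ] ℂ) (s : Finset (ℕ × ℕ)) {C : ℝ} (hC : 0 ≤ C)
    (hb : ∀ᶠ k in atTop, ∀ θ ∈ M, ‖u k θ‖ ≤ C * (s.sup (schwartzSeminormFamily ℂ E ℂ)) θ) :
    ∃ (φ : ℕ → ℕ) (v : 𝓢(E, ℂ) →L[ℂ] ℂ), StrictMono φ ∧
      (∀ θ ∈ M, Tendsto (fun j => u (φ j) θ) atTop (𝓝 (v θ))) ∧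
      ∀ θ, ‖v θ‖ ≤ C * (s.sup (schwartzSeminormFamily ℂ E ℂ)) θ := by
  obtain ⟨φ, v, hφ, hv, hvb⟩ := exists_strictMono_forall_clm_tendsto_on_submodule
    (ι := Unit) (E := fun _ => E) (fun _ => M) (fun k _ => u k) (fun _ => s) (fun _ => C)
    (fun _ => hC) (fun _ => hb)
  exact ⟨φ, v (), hφ, hv (), hvb ()⟩

/-- **One space, bounds everywhere** (values in a proper normed space `F`): if
`u k : 𝓢(E, ℂ) →L[ℂ] F` satisfy `‖u k θ‖ ≤ C · (s.sup p)(θ)` for all `θ` and all large `k`, then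
along a subsequence `u (φ j) θ → v θ` for every `θ`, with `v : 𝓢(E, ℂ) →L[ℂ] F` obeying the same
bound — sequential weak-* compactness of bounded sequences of (`F`-valued) tempered distributions
(Rudin, *Functional Analysis*, Thms. 2.6, 2.8; `exists_strictMono_forall_clm_tendsto` with
`ι = Unit`). [cite: Rudin1991, Thm 2.8] -/
theorem exists_strictMono_clm_tendsto [ProperSpace F] (u : ℕ → 𝓢(E, ℂ) →L[ℂ] F)
    (s : Finset (ℕ × ℕ)) (C : ℝ)
    (hb : ∀ᶠ k in atTop, ∀ θ, ‖u k θ‖ ≤ C * (s.sup (schwartzSeminormFamily ℂ E ℂ)) θ) :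
    ∃ (φ : ℕ → ℕ) (v : 𝓢(E, ℂ) →L[ℂ] F), StrictMono φ ∧
      (∀ θ, Tendsto (fun j => u (φ j) θ) atTop (𝓝 (v θ))) ∧
      ∀ θ, ‖v θ‖ ≤ C * (s.sup (schwartzSeminormFamily ℂ E ℂ)) θ := by
  obtain ⟨φ, v, hφ, hv, hvb⟩ := exists_strictMono_forall_clm_tendsto
    (ι := Unit) (E := fun _ => E) (fun k _ => u k) (fun _ => s) (fun _ => C) (fun _ => hb)
  exact ⟨φ, v (), hφ, hv (), hvb ()⟩

end One

end SchwartzMap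

end Literature.Analysis.FunctionSpaces
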